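import Literature.NumberTheory.GaloisRepresentations.LubinTateColemanReflectionTwo
import Literature.NumberTheory.GaloisRepresentations.LubinTateColemanTraceZero
import HarnessLib

/-!
# `q = 2`: the Coleman family `W_f^1 = {0, −π}` is `F`-rational — it lives in `𝒪_E` for EVERY finite `E ⊇ F`;
# translations of `𝒪_E⟦X⟧` (composition, fixed series, congruences)

De Shalit, *Iwasawa theory of elliptic curves with complex multiplication* (1987), Ch. I §2.1, §3.7–3.9; Ch. III
§1.3: the structure theorem for the semi-local units of the two-variable tower is the one-variable theorem over
every UNRAMIFIED base `k' ⊇ ℚ_p`, where the Coleman power series and the operators `𝒩`, `𝒮` have coefficients in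
`𝒪_{k'}` ("the one-variable structure theorem varies well under unramified extensions", Li–Tian–Yan–Zhu 2025,
Thm. 7.2 at `p = 2`).  The tree's `colemanNorm`/`colemanTrace` have coefficients in `𝒪[F]` (Galois descent from
`K_π^{n+1}`).  AT `q = 2` NO EXTENSION AND NO DESCENT ARE NEEDED: `W_f^1 = {0, −π} ⊂ F`
(`LubinTateColemanReflectionTwo`), so for `f = πX + X²` over `F` with `|𝓀_F| = 2` and ANY finite `E ⊇ F` (think
`E = k'` unramified) Coleman's construction runs inside `𝒪_E⟦X⟧`.  This file: the abstract translation lemmas and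
the family.

* `LubinTate.evT_evT` — `(G(u))(t) = G(u(t))`; `LubinTate.evT_serX_apply` — `G(X) = G`;
  ★ `LubinTate.evT_subst_of_evT_eq` — **a translation fixing `φ` fixes every `R ∘ φ`** (`R ∈ S⟦X⟧`; algebraic: modulo
  `X^{m+1}`, `R ∘ φ` is a polynomial in `φ`); `LubinTate.evT_sub_self_mem_coeffIdeal` — `G(t) ≡ G` modulo a closed
  coefficient ideal containing `t − X`;
* `divPtTwo hπ E : 𝓀_F → 𝔪_E`, `0 ↦ 0`, `c ≠ 0 ↦ −π`; `coe_ltSMul_pi_two` (`[π]y = y(y + π)`),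
  `eq_zero_or_eq_neg_of_ltSMul_pi_eq_zero` (the `π`-torsion of `𝔪_E` is `{0, −π}`), `ltAdd_divPtTwo_one_one`
  (`(−π) [+] (−π) = 0`), and ★ `isColemanFamily_divPtTwo` — **`{0, −π}` is a Coleman family in `𝒪_E`**
  (`f = X(X + π)`), the input of the tree's `f`-adic expansion `LubinTate.invSer` over `𝒪_E`.

Sequels: the reflection `G ↦ G(−π − X)` and the operators `𝒩_E`, `𝒮_E` on `𝒪_E⟦X⟧`
(`LubinTateColemanRelativeTraceTwo`), their kernel and image (`LubinTateColemanRelativeKernelTwo`).  0 sorry, no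
named facts.

## References

* E. de Shalit, *Iwasawa theory of elliptic curves with complex multiplication* (1987), Ch. I §1.7, §2.1, §3.7–3.9;
  Ch. III §1.3. [deShalit1987]
* Y. Li, Y. Tian, H. Yan, X. Zhu, *On the Birch and Swinnerton-Dyer conjecture for certain rational elliptic
  curves*, PAMQ 21 (2025), Thm. 7.2. [li2025-birch-swinnerton-dyer-conjecture-rational-elliptic-curves]
-/

noncomputable section

open scoped PowerSeries.WithPiTopology

namespace Literature.NumberTheory.GaloisRepresentations

namespace LubinTate

/-! ### Composition of translations of `S⟦X⟧` -/

section EvT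

variable {A : Type*} [CommRing A] [UniformSpace A] [DiscreteUniformity A]
variable {S : Type*} [CommRing S] [UniformSpace S] [IsUniformAddGroup S] [IsTopologicalRing S]
  [IsLinearTopology S S] [T2Space S] [CompleteSpace S] [Algebra A S] [ContinuousSMul A S]
variable (M : NilIdeal S)

omit [UniformSpace A] [DiscreteUniformity A] [Algebra A S] [ContinuousSMul A S] in
/-- **`(G(u))(t) = G(u(t))`** for `G ∈ S⟦X⟧` and points `t, u` of `S⟦X⟧` (composition of the translations used in
Coleman's construction). [cite: deShalit1987, Ch. I §2.1] -/
theorem evT_evT (t u : (seriesNilIdeal M).toIdeal) (G : PowerSeries S) :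
    evT M t (evT M u G) = evT M (evTPt M t u) G := by
  have hc := continuous_evT M t
  have key := MvPowerSeries.comp_aeval
    (PowerSeries.hasEval ((seriesNilIdeal M).isTopologicallyNilpotent _ u.2)) hc
  have h' := congrArg (fun φ => φ (G : MvPowerSeries Unit S)) key
  simp only [AlgHom.coe_comp, Function.comp_apply] at h'
  exact h'.trans (aeval_congr_family _ _ (funext fun _ => rfl) _)

omit [UniformSpace A] [DiscreteUniformity A] [Algebra A S] [ContinuousSMul A S] in
/-- **`G(X) = G`**: translation by the point `X` (= by `ω_0 = 0`) is the identity. [cite: deShalit1987, Ch. I §2.1] -/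
theorem evT_serX_apply (G : PowerSeries S) : evT M (serX M) G = G := by
  have hid : Continuous (AlgHom.id S (PowerSeries S)) := continuous_id
  have h1 := PowerSeries.aeval_unique hid
  have e : evT M (serX M) G = AlgHom.id S (PowerSeries S) G := by
    rw [← h1, evT]
    exact PowerSeries_aeval_congr _ _ rfl G
  rw [e, AlgHom.id_apply]

end EvT

section EvTSubst

variable {S : Type*} [CommRing S] [UniformSpace S] [IsUniformAddGroup S] [IsTopologicalRing S]
  [IsLinearTopology S S] [T2Space S] [CompleteSpace S]
variable (M : NilIdeal S)

/-- **A translation fixing `φ` fixes every `R ∘ φ`** (`φ(0) = 0`): if `φ(t) = φ` then `(R ∘ φ)(t) = R ∘ φ` for all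
`R ∈ S⟦X⟧` — purely algebraic: modulo `X^{m+1}`, `R ∘ φ` is a polynomial in `φ`. [cite: deShalit1987, Ch. I §2.1] -/
theorem evT_subst_of_evT_eq (t : (seriesNilIdeal M).toIdeal) {φ : PowerSeries S}
    (hφ0 : PowerSeries.constantCoeff φ = 0) (hφ : evT M t φ = φ) (R : PowerSeries S) :
    evT M t (PowerSeries.subst φ R) = PowerSeries.subst φ R := by
  have hφs : PowerSeries.HasSubst φ := PowerSeries.HasSubst.of_constantCoeff_zero' hφ0
  refine PowerSeries.ext fun m => ?_
  set Q : PowerSeries S := PowerSeries.mk fun i => PowerSeries.coeff (i + (m + 1)) R with hQ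
  have hR := PowerSeries.eq_X_pow_mul_shift_add_trunc (m + 1) R
  have e : PowerSeries.subst φ R =
      φ ^ (m + 1) * PowerSeries.subst φ Q + Polynomial.aeval φ (R.trunc (m + 1)) := by
    conv_lhs => rw [hR]
    rw [← PowerSeries.coe_substAlgHom hφs, map_add, map_mul, map_pow, PowerSeries.substAlgHom_X,
      PowerSeries.substAlgHom_coe]
  have hdvd : ∀ G : PowerSeries S, PowerSeries.coeff m (φ ^ (m + 1) * G) = 0 := fun G => by
    have h1 : (PowerSeries.X : PowerSeries S) ^ (m + 1) ∣ φ ^ (m + 1) * G :=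
      dvd_mul_of_dvd_left (pow_dvd_pow_of_dvd (PowerSeries.X_dvd_iff.mpr hφ0) _) _
    exact PowerSeries.X_pow_dvd_iff.mp h1 m (Nat.lt_succ_self m)
  rw [e, map_add, map_mul, map_pow, hφ, ← Polynomial.aeval_algHom_apply, hφ, map_add, hdvd, map_add, hdvd]

/-- **`G(t) ≡ G` modulo a closed coefficient ideal containing `t − X`** (`G ∈ S⟦X⟧`).
[cite: deShalit1987, Ch. I §2.1] -/
theorem evT_sub_self_mem_coeffIdeal (J : Ideal S) (hJ : IsClosed (J : Set S)) (t : (seriesNilIdeal M).toIdeal)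
    (ht : (t : PowerSeries S) - PowerSeries.X ∈ coeffIdeal J) (G : PowerSeries S) :
    evT M t G - G ∈ coeffIdeal J := by
  have hJ' := isClosed_coeffIdeal (S := S) hJ
  have h1 : HasSum (fun d : ℕ => PowerSeries.coeff d G • ((t : PowerSeries S) ^ d)) (evT M t G) :=
    PowerSeries.hasSum_aeval _ G
  have h2 : HasSum (fun d : ℕ => PowerSeries.coeff d G • ((PowerSeries.X : PowerSeries S) ^ d)) G := by
    have hid := PowerSeries.aeval_unique (ε := AlgHom.id S (PowerSeries S)) continuous_id
    have h3 := congrArg (fun φ => φ G) hid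
    simp only [AlgHom.id_apply] at h3
    have e : PowerSeries.aeval (PowerSeries.HasEval.X (R := S)) G = G :=
      (PowerSeries_aeval_congr (PowerSeries.HasEval.X (R := S)) _ rfl G).trans h3
    have := PowerSeries.hasSum_aeval (PowerSeries.HasEval.X (R := S)) G
    rwa [e] at this
  refine hJ'.mem_of_tendsto (h1.sub h2) (Filter.Eventually.of_forall fun s => ?_)
  refine Ideal.sum_mem _ fun d _ => ?_
  rw [← smul_sub, Algebra.smul_def]
  refine Ideal.mul_mem_left _ _ ?_
  rw [← Ideal.Quotient.eq, map_pow, map_pow, (Ideal.Quotient.eq).mpr ht]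

end EvTSubst


end LubinTate

section LocalFieldRel2

open GaloisRepresentations.IsNonarchimedeanLocalField LubinTate ValuativeRel

variable (F : Type*) [Field F] [ValuativeRel F] [TopologicalSpace F] [IsNonarchimedeanLocalField F]

attribute [local instance] ltNormUniformSpace ltNormIsUniformAddGroup rk1 nF nE fintypeResidueField

variable {F}
variable {π : 𝒪[F]} (hπ : (valuation F).IsUniformizer (π : F))
variable (E : IntermediateField F (AlgebraicClosure F)) [FiniteDimensional F E]

/-! ### The rational Coleman family `{0, −π} ⊂ 𝒪_E` at `q = 2` -/

include hπ in
/-- `−π ∈ 𝔪_E`. [cite: deShalit1987, Ch. I §1.7] -/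
theorem neg_algebraMap_pi_mem_maxNilIdeal : -(algebraMap 𝒪[F] (unitBall E) π) ∈ (maxNilIdeal F E).toIdeal :=
  neg_mem (algebraMap_mem_maxNilIdeal_of_dvd hπ (dvd_refl π))

/-- **The Coleman family at `q = 2` inside `𝒪_E`**: `ω_0 = 0`, `ω_c = −π` for `c ≠ 0`. [cite: deShalit1987, Ch. I §1.7] -/
def divPtTwo (c : 𝓀[F]) : (maxNilIdeal F E).toIdeal :=
  haveI := Classical.dec (c = 0)
  if c = 0 then 0 else ⟨-(algebraMap 𝒪[F] (unitBall E) π), neg_algebraMap_pi_mem_maxNilIdeal hπ E⟩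

/-- `ω_0 = 0`. [cite: deShalit1987, Ch. I §1.7] -/
theorem divPtTwo_zero : divPtTwo hπ E 0 = 0 := by
  rw [divPtTwo]; exact dif_pos rfl

/-- `ω_c = −π` for `c ≠ 0`. [cite: deShalit1987, Ch. I §1.7] -/
theorem coe_divPtTwo_of_ne_zero {c : 𝓀[F]} (hc : c ≠ 0) :
    ((divPtTwo hπ E c : (maxNilIdeal F E).toIdeal) : unitBall E) = -(algebraMap 𝒪[F] (unitBall E) π) := by
  rw [divPtTwo, if_neg hc]

include hπ in
/-- `π ≠ 0` in `𝒪_E`. [cite: deShalit1987, Ch. I §1.7] -/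
theorem algebraMap_pi_ne_zero : (algebraMap 𝒪[F] (unitBall E) π) ≠ 0 := fun h0 =>
  hπ.ne_zero (by
    have h1 := congrArg (fun s : unitBall E => (s : E)) h0
    rw [algebraMap_integer_apply, ZeroMemClass.coe_zero, map_eq_zero] at h1
    exact h1)

/-- **`[π] y = f(y) = y (y + π)`** on points of `𝔪_E` at `q = 2`. [cite: deShalit1987, Ch. I §1.7] -/
theorem coe_ltSMul_pi_two (hq : residueFieldCard F = 2) (y : (maxNilIdeal F E).toIdeal) :
    ((ltSMul (maxNilIdeal F E) (isLTRing_LTCoeff hπ) (isLTSeries_LTCoeff π) (LTCoeff.of F π) y : unitBall E) : E) =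
      ((y : unitBall E) : E) * (((y : unitBall E) : E) + algebraMap F E π) := by
  rw [coe_ltSMul_pi hπ, ltPoly, hq, Polynomial.map_add, Polynomial.map_mul, Polynomial.map_pow, Polynomial.map_C,
    Polynomial.map_X, Polynomial.aeval_add, Polynomial.aeval_mul, Polynomial.aeval_C, map_pow, Polynomial.aeval_X]
  change algebraMap F E (π : F) * _ + _ = _
  ring

/-- **The `π`-torsion points of `𝔪_E` at `q = 2` are `0` and `−π`.** [cite: deShalit1987, Ch. I §1.7] -/
theorem eq_zero_or_eq_neg_of_ltSMul_pi_eq_zero (hq : residueFieldCard F = 2) {y : (maxNilIdeal F E).toIdeal}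
    (hy : ltSMul (maxNilIdeal F E) (isLTRing_LTCoeff hπ) (isLTSeries_LTCoeff π) (LTCoeff.of F π) y = 0) :
    y = 0 ∨ ((y : unitBall E) : E) = -(algebraMap F E π) := by
  have h := coe_ltSMul_pi_two hπ E hq y
  rw [hy, ZeroMemClass.coe_zero, ZeroMemClass.coe_zero, eq_comm, mul_eq_zero] at h
  rcases h with h | h
  · left; exact Subtype.ext (Subtype.ext h)
  · right; exact eq_neg_of_add_eq_zero_left h

/-- `[π] ω_c = 0`. [cite: deShalit1987, Ch. I §1.7] -/
theorem ltSMul_divPtTwo (hq : residueFieldCard F = 2) (c : 𝓀[F]) :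
    ltSMul (maxNilIdeal F E) (isLTRing_LTCoeff hπ) (isLTSeries_LTCoeff π) (LTCoeff.of F π) (divPtTwo hπ E c) = 0 := by
  by_cases hc : c = 0
  · rw [hc, divPtTwo_zero, ltSMul_zero]
  · apply Subtype.ext; apply Subtype.ext
    rw [coe_ltSMul_pi_two hπ E hq, coe_divPtTwo_of_ne_zero hπ E hc, ZeroMemClass.coe_zero, ZeroMemClass.coe_zero,
      Subring.coe_neg, algebraMap_integer_apply, neg_add_cancel, mul_zero]

/-- `(−π) [+] (−π) = 0` (it is `π`-torsion and is not `−π`). [cite: deShalit1987, Ch. I §1.7] -/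
theorem ltAdd_divPtTwo_one_one (hq : residueFieldCard F = 2) :
    ltAdd (maxNilIdeal F E) (isLTRing_LTCoeff hπ) (isLTSeries_LTCoeff π) (divPtTwo hπ E 1) (divPtTwo hπ E 1) = 0 := by
  set M := maxNilIdeal F E
  set ω := divPtTwo hπ E 1 with hω
  have htors : ltSMul M (isLTRing_LTCoeff hπ) (isLTSeries_LTCoeff π) (LTCoeff.of F π)
      (ltAdd M (isLTRing_LTCoeff hπ) (isLTSeries_LTCoeff π) ω ω) = 0 := by
    rw [ltSMul_ltAdd, ltSMul_divPtTwo hπ E hq, ltAdd_zero]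
  rcases eq_zero_or_eq_neg_of_ltSMul_pi_eq_zero hπ E hq htors with h | h
  · exact h
  · exfalso
    have hωω : ltAdd M (isLTRing_LTCoeff hπ) (isLTSeries_LTCoeff π) ω ω = ω := by
      apply Subtype.ext; apply Subtype.ext
      rw [h, hω, coe_divPtTwo_of_ne_zero hπ E one_ne_zero, Subring.coe_neg, algebraMap_integer_apply]
    have hω0 : ω = 0 := by
      have e := congrArg (fun y => ltAdd M (isLTRing_LTCoeff hπ) (isLTSeries_LTCoeff π) y
        (ltNeg M (isLTRing_LTCoeff hπ) (isLTSeries_LTCoeff π) ω)) hωω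
      rwa [ltAdd_assoc, ltAdd_ltNeg, ltAdd_zero] at e
    have := congrArg (fun y : M.toIdeal => (y : unitBall E)) hω0
    simp only [hω, coe_divPtTwo_of_ne_zero hπ E one_ne_zero, ZeroMemClass.coe_zero, neg_eq_zero] at this
    exact algebraMap_pi_ne_zero hπ E this

/-- `f ↦ 𝒪_E⟦X⟧` is `C π · X + X²`. [cite: deShalit1987, Ch. I §1.7] -/
private theorem map_ltSer_eq' (hq : residueFieldCard F = 2) :
    (ltSer F π).map (algebraMap (LTCoeff F) (unitBall E)) =
      PowerSeries.C (algebraMap 𝒪[F] (unitBall E) π) * PowerSeries.X + PowerSeries.X ^ 2 := by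
  have e : ltSer F π = PowerSeries.C (LTCoeff.of F π) * PowerSeries.X + PowerSeries.X ^ residueFieldCard F := by
    change ((ltPoly F π : Polynomial 𝒪[F]) : PowerSeries 𝒪[F]) = _
    rw [ltPoly, Polynomial.coe_add, Polynomial.coe_mul, Polynomial.coe_pow, Polynomial.coe_C, Polynomial.coe_X]
    rfl
  rw [e, hq, map_add, map_mul, map_pow, PowerSeries.map_C, PowerSeries.map_X]
  rfl

/-- ★ **`{0, −π}` is a Coleman family in `𝒪_E`** at `q = 2`: killed by `[π]`, stable under translation by its
members, injective, and `f = ∏_c (X − ω_c) = X(X + π)`. [cite: deShalit1987, Ch. I §2.1] -/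
theorem isColemanFamily_divPtTwo (hq : residueFieldCard F = 2) :
    IsColemanFamily (maxNilIdeal F E) (isLTRing_LTCoeff hπ) (isLTSeries_LTCoeff π) (divPtTwo hπ E) where
  ltSMul_eq_zero := ltSMul_divPtTwo hπ E hq
  exists_perm c := by
    classical
    rcases eq_zero_or_eq_one_two hq c with rfl | rfl
    · exact ⟨Equiv.refl _, fun j => by rw [divPtTwo_zero, zero_ltAdd]; rfl⟩
    · refine ⟨Equiv.swap 0 1, fun j => ?_⟩
      rcases eq_zero_or_eq_one_two hq j with rfl | rfl
      · rw [divPtTwo_zero, ltAdd_zero, Equiv.swap_apply_left]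
      · rw [ltAdd_divPtTwo_one_one hπ E hq, Equiv.swap_apply_right, divPtTwo_zero]
  injective c c' h := by
    by_contra hne
    rcases eq_zero_or_eq_one_two hq c with rfl | rfl <;> rcases eq_zero_or_eq_one_two hq c' with rfl | rfl
    · exact hne rfl
    · have := congrArg (fun y : (maxNilIdeal F E).toIdeal => (y : unitBall E)) h
      simp only [divPtTwo_zero, ZeroMemClass.coe_zero, coe_divPtTwo_of_ne_zero hπ E one_ne_zero, zero_eq_neg] at this
      exact algebraMap_pi_ne_zero hπ E this
    · have := congrArg (fun y : (maxNilIdeal F E).toIdeal => (y : unitBall E)) h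
      simp only [divPtTwo_zero, ZeroMemClass.coe_zero, coe_divPtTwo_of_ne_zero hπ E one_ne_zero, neg_eq_zero] at this
      exact algebraMap_pi_ne_zero hπ E this
    · exact hne rfl
  map_eq_prod := by
    rw [Fintype.prod_eq_mul 0 1 zero_ne_one (fun c hc => absurd (eq_zero_or_eq_one_two hq c) (not_or.mpr hc)),
      divPtTwo_zero, ZeroMemClass.coe_zero, map_zero, sub_zero, coe_divPtTwo_of_ne_zero hπ E one_ne_zero, map_neg,
      sub_neg_eq_add]
    change (ltSer F π).map _ = _
    rw [map_ltSer_eq' E hq]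
    ring

end LocalFieldRel2


end Literature.NumberTheory.GaloisRepresentations
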